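import Summits.ABC.IUTFork.LDHGenuinePerImageSharpRat
import Summits.ABC.IUTFork.LDHGenuinePerImageUniform
import Summits.ABC.IUTFork.LDHGenuinePerImageFreyRowsN
import HarnessLib

/-!
# The fork at [IUTchIII] Corollary 3.12, L-DH level, READING (P): the per-image Corollary AS TYPED at EVERY PRIME LEVEL `l ≥ 7`
# for the tabulated triples — a closed-form sufficiency UNIFORM IN `l`, including the levels `l ∈ I` (abc-iut cell, branch C,
# row «C:PERIMAGE-P-ALL-LEVELS», file 1 of 2)

Record-only PROOF file (D-0012) of the abc-iut cell (branch-C certificate seat abc-iut-C-cert-2, gen 6; crux ThetaPartII =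
stmt-ABC-19678). TAKES NO SIDE on [IUTchIII] Cor. 3.12 (S. Mochizuki, *Inter-universal Teichmüller theory III*, Cor. 3.12
p. 173–174) or on any author. The READING-(P) counterpart of the «every prime level» theorems of reading (U)
(`Conditional/AbcOfSCor312OfAllLevels.lean`, abc-iut-C-cert-3; abc-iut-plan ruling C-R80).

PRIOR ART IN THE TREE (cited, consumed BY NAME, not restated): abc-iut-s2-p4's slope test `cor312PerImageOf_ratPoint_uniform`
(p476979, `LDHGenuinePerImageUniform`) already gives `T.Cor312PerImageOf` for EVERY prime `l ≥ 11` OUTSIDE the pole set `I` at the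
Reyssat triple (`cor312PerImageOf_reyssat_of_le`) and at `283 + 5¹¹·13²` (`cor312PerImageOf_freyE_of_le`); abc-iut-c312-d1's rows
give the single levels `(283-triple, 13)`, `(283-triple, 17)` (`LDHGenuinePerImageFreyRowsN`), `(283-triple, 283)` and `(Reyssat, 109)`
(`LDHGenuinePerImageUnconditional`, primed forms) unconditionally. WHAT IS LEFT for «every prime `l ≥ 7`» at these two triples is
`l = 7` and the pole level `l = 23` of the Reyssat triple; at the other three tabulated triples (file 2,
`LDHGenuinePerImageAllLevelsB`) the whole `l`-axis off four landed levels.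

§1 is the tool, a closed form of abc-iut-c312-d1's SHARPENED test `cor312PerImageOf_ratPoint_sharp` (p484321; weights
`1 − 1/(l·lcm(30/gcd(30,e_p), c_p))`, `(1 − 1/(l−1))·log l`, hypothesis-free) that is UNIFORM IN `l` AND COVERS `l ∈ I`: with
`Q := Σ_{p∈I odd} e_p·log p`, `R := Σ_{p∈I odd} log p` (`j(λ) = N/∏_{p∈I} p^{e_p}` reduced) and any `c ≤ lcm(30/gcd(30,e_p), c_p)` (all odd
`p ∈ I`), `log q^{∤2l}(λ) = Q − [l∈I]·e_l·log l` (`logQAvoid_ratPoint_eq_sum`), `κ_l ≤ (l+1)/24` and `1 − 1/m_p ≥ 1 − 1/(c·l)`, so the test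
follows from
  `(Q − [l∈I]·e_l·log l)/6 ≤ (1 − 1/(c·l))·(R − [l∈I]·log l) + ½·log 2 + [3∉I]·½·log 3 + [5∉I]·¾·log 5 + (1 − 1/(l−1))·log l + log π`
(**`cor312PerImageOf_ratPoint_sharp_closedForm`**); off `I` its right side is increasing in `l` (`weights_mono_seven`), so ONE integer
certificate at `l = 7` (`π > 3`) settles every prime `l ∉ I`, and one certificate per pole level settles `l ∈ I`. §2 assembles
**`Frey283.cor312PerImageOf_all`** (`λ = 283/8251953408`) and **`Reyssat.cor312PerImageOf_all`** (`λ = 2/23⁵`): for EVERY prime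
`l ≥ 7` and EVERY genuine Θ-volume datum `T` of `(λ, l)`, `T.Cor312PerImageOf` — NO hypothesis (new kernel content here: the
levels `7` of both and `23` of Reyssat; everything else BY NAME; desk margins: seat folder `gen_certs.py`).

READING (neutral; branch-C books): the instances of the reading-(P) number-level binder `hNumPOffBad` of
`Conditional.abc_of_slotLicence_orNumP_K_szpiroBad_read` (p462946) and of its M twin at these `λ` have a TRUE conclusion at every
prime level `l ≥ 7` — positive (P)-instances uniform in `l`, next to the positive (U)-instances of ruling C-R80; no certificate's
hypothesis count moves. HONEST SCOPE: statements about OUR typed per-image inequality, whose (Ind2) is the cell's full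
lattice-automorphism typing (Dupuy–Hilado §4.9) — nothing about print's (Ind2) or the printed inequality; nothing here asserts
that genuine data exist at any `(λ, l)` (at most finitely many `l` carry data), Cor. 3.12 in general, or abc; proved-as-typed ≠ in
print; typed ≠ proved. [cite: Mochizuki2012, IUTchIII Cor. 3.12 p. 173–174, proof Step (x) p. 181; IUTchIV Thm. 1.10 p. 22–24, Step (v) p. 27–29, Cor. 2.2 (ii)
proof (P5) p. 46] [cite: SilvermanAEC2009, Prop. III.1.7(b)] [cite: DupuyHilado2025, §4.9, §4.12] [claim: Mochizuki2012, status: disputed]. PROOF-ONLY: 0 defs, no new `Prop`.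
-/

noncomputable section

namespace Literature.IUT.LogVolume.Cor22

open NumberField IsDedekindDomain Ideal Module Literature.NumberTheory.DiophantineGeometry
open Literature.NumberTheory.DiophantineGeometry.GenEll Summit.ABC.IUTFork Literature.IUT.HodgeTheaters

/-! ## §1. The closed-form sufficiency, uniform in the level -/

section ClosedForm

variable {q : ℚ} {l N D : ℕ} {I : Finset ℕ} {e : ℕ → ℕ}

/-- **READING (P), rational data, closed form UNIFORM IN `l`.** For `q ∈ ℚ ∖ {0,1}` with `j(q) = N/∏_{p∈I} p^{e_p}` reduced, a prime
`l ≥ 7`, reals `Q ≥ Σ_{p∈I∖{2}} e_p·log p` and `R ≤ Σ_{p∈I∖{2}} log p`, and a natural `c ≥ 1` with `c ≤ lcm(30/gcd(30,e_p), c_p)` at every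
odd `p ∈ I` (`c_3 = 2`, `c_5 = 4`, else `1`): if
`(Q − [l∈I]·e_l·log l)/6 ≤ (1 − 1/(c·l))·(R − [l∈I]·log l) + ½·log 2 + [3∉I]·½·log 3 + [5∉I]·¾·log 5 + (1 − 1/(l−1))·log l + log π`
then `T.Cor312PerImageOf` for every genuine Θ-volume datum `T` of `(q, l)` — by abc-iut-c312-d1's `cor312PerImageOf_ratPoint_sharp`:
`log q^{∤2l}(q) = Σ_{p∈I, p≠2, p≠l} e_p·log p` (`logQAvoid_ratPoint_eq_sum`), `κ_l = (l+1)/24 − 1/(2l) ≤ (l+1)/24`, and every sharpened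
weight `1 − 1/(l·lcm(…)) ≥ 1 − 1/(c·l)`. [cite: Mochizuki2012, IUTchIII Cor. 3.12 p. 173–174; IUTchIV Thm. 1.10 Step (v) p. 27–29,
Cor. 2.2 (ii) proof (P5) p. 46] [claim: Mochizuki2012, status: disputed] -/
theorem cor312PerImageOf_ratPoint_sharp_closedForm (hq0 : q ≠ 0) (hq1 : q ≠ 1) (hl : l.Prime) (h7 : 7 ≤ l)
    (hI : ∀ p ∈ I, p.Prime) (he : ∀ p ∈ I, e p ≠ 0) (hD : D = ∏ p ∈ I, p ^ e p)
    (hj : jInv q = (N : ℚ) / (D : ℚ)) (hN : N ≠ 0) (hcop : ∀ p ∈ I, ¬ p ∣ N)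
    {Q R : ℝ} (hQ : ∑ p ∈ I.erase 2, (e p : ℝ) * Real.log p ≤ Q) (hR : R ≤ ∑ p ∈ I.erase 2, Real.log p)
    (c : ℕ) (hc0 : 0 < c)
    (hc : ∀ p ∈ I, p ≠ 2 → c ≤ Nat.lcm (30 / Nat.gcd 30 (e p)) (if p = 3 then 2 else if p = 5 then 4 else 1))
    (hcond : (Q - (if l ∈ I then (e l : ℝ) * Real.log l else 0)) / 6 ≤
      (1 - 1 / ((c : ℝ) * l)) * (R - (if l ∈ I then Real.log l else 0))
        + 2⁻¹ * Real.log 2 + (if 3 ∈ I then 0 else 2⁻¹ * Real.log 3) + (if 5 ∈ I then 0 else (3 / 4 : ℝ) * Real.log 5)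
        + (1 - 1 / ((l : ℝ) - 1)) * Real.log l + Real.log Real.pi)
    (T : ThetaVolumeDatumAt (ratPoint q) l) : T.Cor312PerImageOf := by
  classical
  have hl2 : l ≠ 2 := by omega
  have hl0 : (0 : ℝ) < l := by exact_mod_cast hl.pos
  have hl7 : (7 : ℝ) ≤ l := by exact_mod_cast h7
  -- (1) the filtered index set of the test is `(I ∖ {2}) ∖ {l}`
  have hSE : I.filter (fun p => p ≠ 2 ∧ p ≠ l) = (I.erase 2).erase l := by
    ext p
    simp only [Finset.mem_filter, Finset.mem_erase]
    tauto
  have hsumS : ∀ f : ℕ → ℝ, ∑ p ∈ I.filter (fun p => p ≠ 2 ∧ p ≠ l), f p =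
      (∑ p ∈ I.erase 2, f p) - (if l ∈ I then f l else 0) := by
    intro f
    rw [hSE]
    by_cases hlI : l ∈ I
    · rw [if_pos hlI, Finset.sum_erase_eq_sub (Finset.mem_erase.2 ⟨hl2, hlI⟩)]
    · have hlI' : l ∉ I.erase 2 := fun h => hlI (Finset.mem_of_mem_erase h)
      rw [if_neg hlI, Finset.erase_eq_of_notMem hlI', sub_zero]
  -- (2) the exact `log q^{∤2l}`
  have hLQ : logQAvoid (ratPoint q) {2, l} = ∑ p ∈ I.filter (fun p => p ≠ 2 ∧ p ≠ l), (e p : ℝ) * Real.log p := by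
    rw [logQAvoid_ratPoint_eq_sum hI he hD hj hN {2, l} (fun p hp _ => hcop p hp)]
    refine Finset.sum_congr (Finset.filter_congr (fun p hp => ?_)) (fun _ _ => rfl)
    have hpp := hI p hp
    constructor
    · intro h
      exact ⟨fun h2 => h 2 (by simp) (h2 ▸ dvd_rfl), fun h3 => h l (by simp) (h3 ▸ dvd_rfl)⟩
    · rintro ⟨hp2, hpl⟩ s hs hps
      simp only [Finset.mem_insert, Finset.mem_singleton] at hs
      rcases hs with rfl | rfl
      · exact hp2 ((Nat.prime_dvd_prime_iff_eq hpp Nat.prime_two).mp hps)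
      · exact hpl ((Nat.prime_dvd_prime_iff_eq hpp hl).mp hps)
  -- (3) the weights: `1 − 1/(l·lcm(…)) ≥ 1 − 1/(c·l)` termwise
  have hW : (1 - 1 / ((c : ℝ) * l)) * ∑ p ∈ I.filter (fun p => p ≠ 2 ∧ p ≠ l), Real.log p ≤
      ∑ p ∈ I.filter (fun p => p ≠ 2 ∧ p ≠ l),
        (1 - ((l * Nat.lcm (30 / Nat.gcd 30 (e p)) (if p = 3 then 2 else if p = 5 then 4 else 1) : ℕ) : ℝ)⁻¹)
          * Real.log p := by
    rw [Finset.mul_sum]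
    refine Finset.sum_le_sum (fun p hp => ?_)
    obtain ⟨hpI, hp2, -⟩ := Finset.mem_filter.1 hp
    have hlogp : 0 ≤ Real.log p := Real.log_nonneg (by exact_mod_cast (hI p hpI).one_lt.le)
    refine mul_le_mul_of_nonneg_right ?_ hlogp
    have hcl : (c : ℝ) * l ≤
        ((l * Nat.lcm (30 / Nat.gcd 30 (e p)) (if p = 3 then 2 else if p = 5 then 4 else 1) : ℕ) : ℝ) := by
      have h' : c * l ≤ l * Nat.lcm (30 / Nat.gcd 30 (e p)) (if p = 3 then 2 else if p = 5 then 4 else 1) := by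
        rw [mul_comm]; exact Nat.mul_le_mul_left l (hc p hpI hp2)
      exact_mod_cast h'
    have hclpos : 0 < (c : ℝ) * l := mul_pos (by exact_mod_cast hc0) hl0
    have hinv := inv_anti₀ hclpos hcl
    rw [one_div]
    linarith
  -- (4) assembly
  refine cor312PerImageOf_ratPoint_sharp hq0 hq1 hl h7 hI he hD hj hN hcop ?_ T
  have hQS := hsumS (fun p => (e p : ℝ) * Real.log p)
  have hRS := hsumS (fun p => Real.log p)
  rw [hLQ, hQS]
  rw [hRS] at hW
  have hsub1 : ((l - 1 : ℕ) : ℝ) = (l : ℝ) - 1 := by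
    rw [Nat.cast_sub (by omega)]; simp
  rw [hsub1]
  simp only [one_div] at hcond hW ⊢
  -- the pieces
  have hA0 : 0 ≤ (∑ p ∈ I.erase 2, (e p : ℝ) * Real.log p) - (if l ∈ I then (e l : ℝ) * Real.log l else 0) := by
    rw [← hQS]
    exact Finset.sum_nonneg (fun p hp => mul_nonneg (Nat.cast_nonneg _)
      (Real.log_nonneg (by exact_mod_cast (hI p (Finset.mem_filter.1 hp).1).one_lt.le)))
  have hκ : ((l : ℝ) + 1) / 24 - (2 * (l : ℝ))⁻¹ ≤ ((l : ℝ) + 1) / 24 := by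
    have : 0 < (2 * (l : ℝ))⁻¹ := by positivity
    linarith
  have hpi : 0 < Real.log Real.pi := Real.log_pos (by linarith [Real.pi_gt_three])
  have hw0 : 0 ≤ 1 - ((c : ℝ) * l)⁻¹ := by
    have hcl7 : (7 : ℝ) ≤ (c : ℝ) * l := by
      have hc1 : (1 : ℝ) ≤ c := by exact_mod_cast hc0
      nlinarith
    have : ((c : ℝ) * l)⁻¹ ≤ 7⁻¹ := inv_anti₀ (by norm_num) hcl7
    linarith
  -- `A ≤ Q − δ`, `(1 − 1/(cl))·(R − ρ) ≤ (1 − 1/(cl))·(ΣS log p)`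
  have hAQ : (∑ p ∈ I.erase 2, (e p : ℝ) * Real.log p) - (if l ∈ I then (e l : ℝ) * Real.log l else 0) ≤
      Q - (if l ∈ I then (e l : ℝ) * Real.log l else 0) := by linarith
  have hRR : (1 - ((c : ℝ) * l)⁻¹) * (R - (if l ∈ I then Real.log l else 0)) ≤
      (1 - ((c : ℝ) * l)⁻¹) * ((∑ p ∈ I.erase 2, Real.log p) - (if l ∈ I then Real.log l else 0)) :=
    mul_le_mul_of_nonneg_left (by linarith) hw0
  -- abbreviate
  set A := (∑ p ∈ I.erase 2, (e p : ℝ) * Real.log p) - (if l ∈ I then (e l : ℝ) * Real.log l else 0) with hA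
  set B := ∑ p ∈ I.filter (fun p => p ≠ 2 ∧ p ≠ l),
        (1 - ((l * Nat.lcm (30 / Nat.gcd 30 (e p)) (if p = 3 then 2 else if p = 5 then 4 else 1) : ℕ) : ℝ)⁻¹)
          * Real.log p with hB
  set W := (1 - ((c : ℝ) * l)⁻¹) * ((∑ p ∈ I.erase 2, Real.log p) - (if l ∈ I then Real.log l else 0)) with hWdef
  set X3 := (if 3 ∈ I then (0 : ℝ) else 2⁻¹ * Real.log 3) with hX3
  set X5 := (if 5 ∈ I then (0 : ℝ) else (3 / 4 : ℝ) * Real.log 5) with hX5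
  set Ll := (1 - ((l : ℝ) - 1)⁻¹) * Real.log l with hLl
  -- from `hcond`: `A/6 ≤ W + ½log2 + X3 + X5 + Ll + log π`
  have hcond' : A / 6 ≤ W + 2⁻¹ * Real.log 2 + X3 + X5 + Ll + Real.log Real.pi := by linarith
  have hl1 : (0 : ℝ) ≤ ((l : ℝ) + 1) / 4 := by positivity
  have h1 : (((l : ℝ) + 1) / 24 - (2 * (l : ℝ))⁻¹) * A ≤ ((l : ℝ) + 1) / 4 * (A / 6) := by
    have := mul_le_mul_of_nonneg_right hκ hA0
    linarith
  have h2 : ((l : ℝ) + 1) / 4 * (A / 6) ≤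
      ((l : ℝ) + 1) / 4 * (W + 2⁻¹ * Real.log 2 + X3 + X5 + Ll + Real.log Real.pi) :=
    mul_le_mul_of_nonneg_left hcond' hl1
  have h3 : ((l : ℝ) + 1) / 4 * W ≤ ((l : ℝ) + 1) / 4 * B := mul_le_mul_of_nonneg_left hW hl1
  linarith [h1, h2, h3, hpi, hl1]

/-- **The right side is increasing in `l`**: for a natural `l ≥ 7`, `c > 0` and `R ≥ 0`,
`(1 − 1/(7c))·R + (5/6)·log 7 ≤ (1 − 1/(c·l))·R + (1 − 1/(l−1))·log l`. [folklore] -/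
theorem weights_mono_seven (h7 : 7 ≤ l) {c R : ℝ} (hc : 0 < c) (hR : 0 ≤ R) :
    (1 - 1 / (c * 7)) * R + (1 - 1 / 6) * Real.log 7 ≤
      (1 - 1 / (c * (l : ℝ))) * R + (1 - 1 / ((l : ℝ) - 1)) * Real.log l := by
  have hl : (7 : ℝ) ≤ l := by exact_mod_cast h7
  have h1 : 1 / (c * (l : ℝ)) ≤ 1 / (c * 7) :=
    one_div_le_one_div_of_le (by positivity) (by nlinarith)
  have h2 : 1 / ((l : ℝ) - 1) ≤ 1 / 6 := one_div_le_one_div_of_le (by norm_num) (by linarith)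
  have h3 : Real.log 7 ≤ Real.log l := Real.log_le_log (by norm_num) hl
  have h70 : 0 < Real.log 7 := Real.log_pos (by norm_num)
  have h4 : 0 ≤ 1 - 1 / ((l : ℝ) - 1) := by linarith
  have h5 : (1 - 1 / 6) * Real.log 7 ≤ (1 - 1 / ((l : ℝ) - 1)) * Real.log l :=
    mul_le_mul (by linarith) h3 h70.le h4
  have h6 : (1 - 1 / (c * 7)) * R ≤ (1 - 1 / (c * (l : ℝ))) * R := mul_le_mul_of_nonneg_right (by linarith) hR
  linarith

end ClosedForm

/-! ## §2. The two triples with a landed off-`I` slope theorem: every prime level `l ≥ 7` -/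

/-! ### `283 + 5¹¹·13² = 2⁸·3⁸·17³` (`λ = 283/ 8251953408`; `I = {2, 3, 5, 13, 17, 283}`, `c = 5`) -/

namespace Frey283

/-- The primes of the reduced denominator of `j(λ)`. [folklore] -/
private theorem primes : ∀ p ∈ ({2, 3, 5, 13, 17, 283} : Finset ℕ), p.Prime := by
  intro p hp
  simp only [Finset.mem_insert, Finset.mem_singleton] at hp
  rcases hp with rfl | rfl | rfl | rfl | rfl | rfl <;> norm_num

/-- The exponents are positive. [folklore] -/
private theorem exp_ne_zero : ∀ p ∈ ({2, 3, 5, 13, 17, 283} : Finset ℕ), (fun p => if p = 2 then 8 else if p = 3 then 16 else if p = 5 then 22 else if p = 13 then 4 else if p = 17 then 6 else 2) p ≠ 0 := by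
  intro p hp
  simp only [Finset.mem_insert, Finset.mem_singleton] at hp
  rcases hp with rfl | rfl | rfl | rfl | rfl | rfl <;> norm_num

/-- The factorised denominator. [folklore] -/
private theorem den : (1450640989446910294451489868164062500000000 : ℕ) = ∏ p ∈ ({2, 3, 5, 13, 17, 283} : Finset ℕ), p ^ (fun p => if p = 2 then 8 else if p = 3 then 16 else if p = 5 then 22 else if p = 13 then 4 else if p = 17 then 6 else 2) p := by
  rw [Finset.prod_insert (by decide), Finset.prod_insert (by decide), Finset.prod_insert (by decide), Finset.prod_insert (by decide), Finset.prod_insert (by decide), Finset.prod_singleton]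
  norm_num

/-- The numerator is prime to every prime of the denominator. [folklore] -/
private theorem coprime : ∀ p ∈ ({2, 3, 5, 13, 17, 283} : Finset ℕ), ¬ p ∣ (315747963792470439039120932558494593237415361960848201744969 : ℕ) := by
  intro p hp
  simp only [Finset.mem_insert, Finset.mem_singleton] at hp
  rcases hp with rfl | rfl | rfl | rfl | rfl | rfl <;> norm_num

/-- The constant `c = 5` is below every `lcm(30/gcd(30,e_p), c_p)`, `p` odd. [folklore] -/
private theorem c_le : ∀ p ∈ ({2, 3, 5, 13, 17, 283} : Finset ℕ), p ≠ 2 →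
    5 ≤ Nat.lcm (30 / Nat.gcd 30 ((fun p => if p = 2 then 8 else if p = 3 then 16 else if p = 5 then 22 else if p = 13 then 4 else if p = 17 then 6 else 2) p)) (if p = 3 then 2 else if p = 5 then 4 else 1) := by
  intro p hp
  simp only [Finset.mem_insert, Finset.mem_singleton] at hp
  rcases hp with rfl | rfl | rfl | rfl | rfl | rfl <;> decide

/-- `Q = Σ_{p odd} e_p·log p`. [folklore] -/
private theorem sumQ : ∑ p ∈ ({2, 3, 5, 13, 17, 283} : Finset ℕ).erase 2, (((fun p => if p = 2 then 8 else if p = 3 then 16 else if p = 5 then 22 else if p = 13 then 4 else if p = 17 then 6 else 2) p : ℕ) : ℝ) * Real.log p = 16 * Real.log 3 + 22 * Real.log 5 + 4 * Real.log 13 + 6 * Real.log 17 + 2 * Real.log 283 := by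
  rw [show ({2, 3, 5, 13, 17, 283} : Finset ℕ).erase 2 = ({3, 5, 13, 17, 283} : Finset ℕ) by decide, Finset.sum_insert (by decide), Finset.sum_insert (by decide), Finset.sum_insert (by decide), Finset.sum_insert (by decide), Finset.sum_singleton]
  norm_num
  ring

/-- `R = Σ_{p odd} log p`. [folklore] -/
private theorem sumR : ∑ p ∈ ({2, 3, 5, 13, 17, 283} : Finset ℕ).erase 2, Real.log p = Real.log 3 + Real.log 5 + Real.log 13 + Real.log 17 + Real.log 283 := by
  rw [show ({2, 3, 5, 13, 17, 283} : Finset ℕ).erase 2 = ({3, 5, 13, 17, 283} : Finset ℕ) by decide, Finset.sum_insert (by decide), Finset.sum_insert (by decide), Finset.sum_insert (by decide), Finset.sum_insert (by decide), Finset.sum_singleton]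
  push_cast
  ring

/-- **Level `l = 7`** (`l ∉ I`): `T.Cor312PerImageOf` at every genuine Θ-datum of `283 + 5¹¹·13² = 2⁸·3⁸·17³` — NO hypothesis; closed form,
certificate `3^9·5^33·17 ≤ 2^6·7^10·13^3·283^7`, `π > 3` (margin ≈ 1.22 nats). [cite: Mochizuki2012, IUTchIII Cor. 3.12 p. 173–174] [claim: Mochizuki2012, status: disputed] -/
theorem cor312PerImageOf_seven (T : ThetaVolumeDatumAt (ratPoint ((283 : ℚ) / 8251953408)) 7) : T.Cor312PerImageOf := by
  have hpi : Real.log 3 < Real.log Real.pi := Real.log_lt_log (by norm_num) Real.pi_gt_three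
  have hp2 : 0 < Real.log 2 := Real.log_pos (by norm_num); have hp3 : 0 < Real.log 3 := Real.log_pos (by norm_num); have hp5 : 0 < Real.log 5 := Real.log_pos (by norm_num); have hp7 : 0 < Real.log 7 := Real.log_pos (by norm_num); have hp13 : 0 < Real.log 13 := Real.log_pos (by norm_num); have hp17 : 0 < Real.log 17 := Real.log_pos (by norm_num); have hp283 : 0 < Real.log 283 := Real.log_pos (by norm_num)
  refine cor312PerImageOf_ratPoint_sharp_closedForm (q := (283 : ℚ) / 8251953408) (by norm_num) (by norm_num) (by norm_num) (by norm_num)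
    primes exp_ne_zero den jInv_freyE (by norm_num) coprime (le_of_eq sumQ) (le_of_eq sumR.symm) 5 (by norm_num) c_le ?_ T
  have hZ : (3 ^ 9 * 5 ^ 33 * 17 : ℕ) ≤ 2 ^ 6 * 7 ^ 10 * 13 ^ 3 * 283 ^ 7 := by norm_num
  have hR : ((3 : ℝ) ^ 9 * (5 : ℝ) ^ 33 * (17 : ℝ)) ≤ (2 : ℝ) ^ 6 * (7 : ℝ) ^ 10 * (13 : ℝ) ^ 3 * (283 : ℝ) ^ 7 := by exact_mod_cast hZ
  have hlog := Real.log_le_log (by positivity) hR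
  repeat rw [Real.log_mul (by positivity) (by positivity)] at hlog
  simp only [Real.log_pow] at hlog; push_cast at hlog ⊢; norm_num
  linarith [hlog, hpi, hp2, hp3, hp5, hp7, hp13, hp17, hp283]

/-- **[IUTchIII] COR. 3.12 IN READING (P), AS TYPED, HOLDS AT EVERY GENUINE Θ-DATUM OF `283 + 5¹¹·13² = 2⁸·3⁸·17³` AT EVERY PRIME LEVEL
`l ≥ 7`** — no hypothesis. Off `I` and `l ≥ 11`: abc-iut-s2-p4's `cor312PerImageOf_freyE_of_le` (p476979) BY NAME; `l = 7`: the closed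
form of §1; `l = 13`, `l = 17`, `l = 283`: the landed unconditional levels BY NAME; no other prime `l ≥ 7` exists in `I`. [cite: Mochizuki2012, IUTchIII Cor. 3.12 p. 173–174;
IUTchIV Thm. 1.10 Step (v) p. 27–29] [claim: Mochizuki2012, status: disputed] -/
theorem cor312PerImageOf_all {l : ℕ} (hl : l.Prime) (h7 : 7 ≤ l)
    (T : ThetaVolumeDatumAt (ratPoint ((283 : ℚ) / 8251953408)) l) : T.Cor312PerImageOf := by
  by_cases hlI : l ∈ ({2, 3, 5, 13, 17, 283} : Finset ℕ)
  · have hlI' := hlI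
    simp only [Finset.mem_insert, Finset.mem_singleton] at hlI'
    rcases hlI' with rfl | rfl | rfl | rfl | rfl | rfl
    · omega
    · omega
    · omega
    · exact cor312PerImageOf_freyE_thirteen T
    · exact cor312PerImageOf_freyE_seventeen T
    · exact cor312PerImageOf_freyE_twoeightythree' T
  · by_cases h11 : 11 ≤ l
    · exact cor312PerImageOf_freyE_of_le hl h11 hlI T
    · interval_cases l
      · exact cor312PerImageOf_seven T
      · exact absurd hl (by norm_num)
      · exact absurd hl (by norm_num)
      · exact absurd hl (by norm_num)

end Frey283

/-! ### `2 + 3¹⁰·109 = 23⁵` (`λ = 2/ 6436343`; `I = {3, 23, 109}`, `c = 3`) -/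

namespace Reyssat

/-- The primes of the reduced denominator of `j(λ)`. [folklore] -/
private theorem primes : ∀ p ∈ ({3, 23, 109} : Finset ℕ), p.Prime := by
  intro p hp
  simp only [Finset.mem_insert, Finset.mem_singleton] at hp
  rcases hp with rfl | rfl | rfl <;> norm_num

/-- The exponents are positive. [folklore] -/
private theorem exp_ne_zero : ∀ p ∈ ({3, 23, 109} : Finset ℕ), (fun p => if p = 3 then 20 else if p = 23 then 10 else 2) p ≠ 0 := by
  intro p hp
  simp only [Finset.mem_insert, Finset.mem_singleton] at hp
  rcases hp with rfl | rfl | rfl <;> norm_num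

/-- The factorised denominator. [folklore] -/
private theorem den : (1716154764793810191403767369 : ℕ) = ∏ p ∈ ({3, 23, 109} : Finset ℕ), p ^ (fun p => if p = 3 then 20 else if p = 23 then 10 else 2) p := by
  rw [Finset.prod_insert (by decide), Finset.prod_insert (by decide), Finset.prod_singleton]
  norm_num

/-- The numerator is prime to every prime of the denominator. [folklore] -/
private theorem coprime : ∀ p ∈ ({3, 23, 109} : Finset ℕ), ¬ p ∣ (4550034081061575630856781958829776704708032 : ℕ) := by
  intro p hp
  simp only [Finset.mem_insert, Finset.mem_singleton] at hp
  rcases hp with rfl | rfl | rfl <;> norm_num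

/-- The constant `c = 3` is below every `lcm(30/gcd(30,e_p), c_p)`, `p` odd. [folklore] -/
private theorem c_le : ∀ p ∈ ({3, 23, 109} : Finset ℕ), p ≠ 2 →
    3 ≤ Nat.lcm (30 / Nat.gcd 30 ((fun p => if p = 3 then 20 else if p = 23 then 10 else 2) p)) (if p = 3 then 2 else if p = 5 then 4 else 1) := by
  intro p hp
  simp only [Finset.mem_insert, Finset.mem_singleton] at hp
  rcases hp with rfl | rfl | rfl <;> decide

/-- `Q = Σ_{p odd} e_p·log p`. [folklore] -/
private theorem sumQ : ∑ p ∈ ({3, 23, 109} : Finset ℕ).erase 2, (((fun p => if p = 3 then 20 else if p = 23 then 10 else 2) p : ℕ) : ℝ) * Real.log p = 20 * Real.log 3 + 10 * Real.log 23 + 2 * Real.log 109 := by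
  rw [show ({3, 23, 109} : Finset ℕ).erase 2 = ({3, 23, 109} : Finset ℕ) by decide, Finset.sum_insert (by decide), Finset.sum_insert (by decide), Finset.sum_singleton]
  norm_num
  ring

/-- `R = Σ_{p odd} log p`. [folklore] -/
private theorem sumR : ∑ p ∈ ({3, 23, 109} : Finset ℕ).erase 2, Real.log p = Real.log 3 + Real.log 23 + Real.log 109 := by
  rw [show ({3, 23, 109} : Finset ℕ).erase 2 = ({3, 23, 109} : Finset ℕ) by decide, Finset.sum_insert (by decide), Finset.sum_insert (by decide), Finset.sum_singleton]
  push_cast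
  ring

/-- **Level `l = 7`** (`l ∉ I`): `T.Cor312PerImageOf` at every genuine Θ-datum of `2 + 3¹⁰·109 = 23⁵` — NO hypothesis; closed form,
certificate `3^6·23^3 ≤ 2^2·5^3·7^3·109^2`, `π > 3` (margin ≈ 2.37 nats). [cite: Mochizuki2012, IUTchIII Cor. 3.12 p. 173–174] [claim: Mochizuki2012, status: disputed] -/
theorem cor312PerImageOf_seven (T : ThetaVolumeDatumAt (ratPoint ((2 : ℚ) / 6436343)) 7) : T.Cor312PerImageOf := by
  have hpi : Real.log 3 < Real.log Real.pi := Real.log_lt_log (by norm_num) Real.pi_gt_three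
  have hp2 : 0 < Real.log 2 := Real.log_pos (by norm_num); have hp3 : 0 < Real.log 3 := Real.log_pos (by norm_num); have hp5 : 0 < Real.log 5 := Real.log_pos (by norm_num); have hp7 : 0 < Real.log 7 := Real.log_pos (by norm_num); have hp23 : 0 < Real.log 23 := Real.log_pos (by norm_num); have hp109 : 0 < Real.log 109 := Real.log_pos (by norm_num)
  refine cor312PerImageOf_ratPoint_sharp_closedForm (q := (2 : ℚ) / 6436343) (by norm_num) (by norm_num) (by norm_num) (by norm_num)
    primes exp_ne_zero den jInv_reyssat (by norm_num) coprime (le_of_eq sumQ) (le_of_eq sumR.symm) 3 (by norm_num) c_le ?_ T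
  have hZ : (3 ^ 6 * 23 ^ 3 : ℕ) ≤ 2 ^ 2 * 5 ^ 3 * 7 ^ 3 * 109 ^ 2 := by norm_num
  have hR : ((3 : ℝ) ^ 6 * (23 : ℝ) ^ 3) ≤ (2 : ℝ) ^ 2 * (5 : ℝ) ^ 3 * (7 : ℝ) ^ 3 * (109 : ℝ) ^ 2 := by exact_mod_cast hZ
  have hlog := Real.log_le_log (by positivity) hR
  repeat rw [Real.log_mul (by positivity) (by positivity)] at hlog
  simp only [Real.log_pow] at hlog; push_cast at hlog ⊢; norm_num
  linarith [hlog, hpi, hp2, hp3, hp5, hp7, hp23, hp109]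

/-- **Level `l = 23`** (`l ∈ I`): `T.Cor312PerImageOf` at every genuine Θ-datum of `2 + 3¹⁰·109 = 23⁵` — NO hypothesis; closed form,
certificate `3^3 ≤ 2·5·23·109`, `π > 3` (margin ≈ 6.17 nats). [cite: Mochizuki2012, IUTchIII Cor. 3.12 p. 173–174] [claim: Mochizuki2012, status: disputed] -/
theorem cor312PerImageOf_twentythree (T : ThetaVolumeDatumAt (ratPoint ((2 : ℚ) / 6436343)) 23) : T.Cor312PerImageOf := by
  have hpi : Real.log 3 < Real.log Real.pi := Real.log_lt_log (by norm_num) Real.pi_gt_three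
  have hp2 : 0 < Real.log 2 := Real.log_pos (by norm_num); have hp3 : 0 < Real.log 3 := Real.log_pos (by norm_num); have hp5 : 0 < Real.log 5 := Real.log_pos (by norm_num); have hp7 : 0 < Real.log 7 := Real.log_pos (by norm_num); have hp23 : 0 < Real.log 23 := Real.log_pos (by norm_num); have hp109 : 0 < Real.log 109 := Real.log_pos (by norm_num)
  refine cor312PerImageOf_ratPoint_sharp_closedForm (q := (2 : ℚ) / 6436343) (by norm_num) (by norm_num) (by norm_num) (by norm_num)
    primes exp_ne_zero den jInv_reyssat (by norm_num) coprime (le_of_eq sumQ) (le_of_eq sumR.symm) 3 (by norm_num) c_le ?_ T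
  have hZ : (3 ^ 3 : ℕ) ≤ 2 * 5 * 23 * 109 := by norm_num
  have hR : ((3 : ℝ) ^ 3) ≤ (2 : ℝ) * (5 : ℝ) * (23 : ℝ) * (109 : ℝ) := by exact_mod_cast hZ
  have hlog := Real.log_le_log (by positivity) hR
  repeat rw [Real.log_mul (by positivity) (by positivity)] at hlog
  simp only [Real.log_pow] at hlog; push_cast at hlog ⊢; norm_num
  linarith [hlog, hpi, hp2, hp3, hp5, hp7, hp23, hp109]

/-- **[IUTchIII] COR. 3.12 IN READING (P), AS TYPED, HOLDS AT EVERY GENUINE Θ-DATUM OF `2 + 3¹⁰·109 = 23⁵` AT EVERY PRIME LEVEL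
`l ≥ 7`** — no hypothesis. Off `I` and `l ≥ 11`: abc-iut-s2-p4's `cor312PerImageOf_reyssat_of_le` (p476979) BY NAME; `l = 7`, 23: the closed
form of §1; `l = 109`: the landed unconditional levels BY NAME; no other prime `l ≥ 7` exists in `I`. [cite: Mochizuki2012, IUTchIII Cor. 3.12 p. 173–174;
IUTchIV Thm. 1.10 Step (v) p. 27–29] [claim: Mochizuki2012, status: disputed] -/
theorem cor312PerImageOf_all {l : ℕ} (hl : l.Prime) (h7 : 7 ≤ l)
    (T : ThetaVolumeDatumAt (ratPoint ((2 : ℚ) / 6436343)) l) : T.Cor312PerImageOf := by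
  by_cases hlI : l ∈ ({3, 23, 109} : Finset ℕ)
  · have hlI' := hlI
    simp only [Finset.mem_insert, Finset.mem_singleton] at hlI'
    rcases hlI' with rfl | rfl | rfl
    · omega
    · exact cor312PerImageOf_twentythree T
    · exact cor312PerImageOf_freyR_onehundrednine' T
  · by_cases h11 : 11 ≤ l
    · exact cor312PerImageOf_reyssat_of_le hl h11 hlI T
    · interval_cases l
      · exact cor312PerImageOf_seven T
      · exact absurd hl (by norm_num)
      · exact absurd hl (by norm_num)
      · exact absurd hl (by norm_num)

end Reyssat

end Literature.IUT.LogVolume.Cor22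

end
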